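import Summits.CriticalPhenomena.CardyFormulaZ2.Theorems.CardySusyWardParafermionFamiliesToSLESixAnchorFamily
import Summits.CriticalPhenomena.CardyFormulaZ2.Theorems.CardyComplexConeEdgePrecompactIpExact
import Literature.Probability.Percolation.HalfPlaneArmDiagonalInputs
import Literature.Probability.Percolation.HalfPlaneOneArmQuasiMultiplicativity

/-!
# The strip anchor (stub S5 of line `strip-anchored-vertex-normalisation`, crux stmt-CriticalPhenomena-10814), V:
# ARM — a free-wall site is joined to the wired arc with probability `≥ c · L^{-1/3}`

Helper file for `stub_anchoredWallFlux` (conditional form `IkhlefPonsaingFirstPassage → AnchoredWallFlux`).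
Main theorem `S5.touchProb_lower`: on the discretised diagonal square `{|x₀+x₁| ≤ L, |x₀-x₁| ≤ L}`
(geometry hypotheses supplied verbatim by `S5.anchor_geometry`), a free-wall site `w` of level `L - 2`
in the middle half of the free side is joined to the WIRED arc `A` by open edges of the completed
configuration `E.bcBondConfig ω` with probability `≥ c · L^{-1/3}`, GIVEN Ikhlef–Ponsaing's exact strip
law (the named fact `IkhlefPonsaingFirstPassage`, IP12 Prop. 4.7, a hypothesis). Proof (Nolin 2008,
§4.3/§4.6 extendability near a straight boundary, with the tree's abstract-coordinate half-plane toolkit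
`HalfPlaneUCatch` / `HalfPlaneCrossingGluing` in the diagonal coordinates `(col, hgtOf)` of
`HalfPlaneArmDiagonalInputs`), in STANDARD POSITION (wall `hgtOf = 0`, domain `hgtOf ≥ 0`; the anchor is
carried there by the lattice automorphism `x ↦ (C - x₁, -x₀)`, `exists_flipIso`, and `P_{1/2}`-invariance,
`bondPercolation_real_image`), with `a = ⌊L/128⌋`:
1. IP as a local arm (`real_stripArm_eq`): the site `b₀ = w₀ + e₀` is joined inside the strip
   `{0 ≤ hgtOf ≤ 2a+1}` to its far side with probability EXACTLY `ipRatio a ≥ (2a+1)^{-1/3}`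
   (`stub_ipExact_of_IkhlefPonsaing`, level flip, `ipRatio_lower`); clipped at half-plane distance `2a`
   it is an open crossing of a finite box (`stripArm_subset`);
2. the U `U[b₀, a]` (probability `≥ c_U`, `real_U_ge`) catches it (`uCatch`), and a deep top–bottom
   crossing of `{|col - col b₀| ≤ a} × {a+1 ≤ hgtOf ≤ 513a+1}` (probability `≥ c_D`, `tb_lower` with
   aspect ratio `256`) meets the bar of the U (`meet`); with the wall edge `s(w₀, b₀)` (probability `1/2`)
   and Harris–FKG, `P ≥ ½ c_U c_D (2a+1)^{-1/3}` for an open path from `w₀` to the level `hgtOf = 2L-3`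
   inside the band `{|col - col w₀| ≤ 2a+1}` (`mem_band_of_glue`, `armStd_lower`);
3. back on the anchor (`reachable_arcA_of_band`): the band stays `L/32`-close to the middle column, so
   all its sites are mesh-domain sites off the arc `B`, its lattice edges are domain edges, and its
   bottom level `-(L-1)` lies on the arc `A`: the open path is `bcBondConfig`-open and ends on `A`.
Registered one-line tickets: `stub_anchor_arm`, `stub_anchor_touchprob`.
-/

noncomputable section

namespace Summit.CriticalPhenomena.CardyFormulaZ2.Theorems.ParafermionFamiliesToSLESix.StripAnchored

open MeasureTheory Set
open Literature.Probability.LatticeModels Literature.Probability.Percolation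
open Literature.Probability.Percolation.TrackExchange
open Literature.Probability.Percolation.HalfPlaneArm
open Summit.CriticalPhenomena.CardyFormulaZ2.Cruxes.EdgePrecompact.QkzStripBoundaryArm (wallConn diagStrip ipRatio
  stub_ipExact_of_IkhlefPonsaing)

/-- **Registered ticket `stub_anchor_arm`**: an open edge inside `S` joins its endpoints inside `S`. [folklore] -/
theorem stub_anchor_arm : ∀ (ω : BondConfig (Site 2)) (S : Set (Site 2)) (x y : Site 2), x ∈ S → y ∈ S → x ≠ y → s(x, y) ∈ ω → ω ∈ openConnIn S x y :=
  fun _ _ _ _ hx hy hne he => openConnIn_of_adj hx hy he hne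

/-- **Registered ticket `stub_anchor_touchprob`**: `δ^{1/3} ≤ x^{-1/3}` for `0 < x ≤ δ⁻¹`. [folklore] -/
theorem stub_anchor_touchprob : ∀ (δ : ℝ), 0 < δ → ∀ (x : ℝ), 0 < x → x ≤ δ⁻¹ → δ ^ ((1:ℝ) / 3) ≤ x ^ (-(1:ℝ) / 3) := by
  intro δ hδ x hx hxδ
  rw [neg_div, Real.rpow_neg hx.le, ← Real.inv_rpow hx.le]
  exact Real.rpow_le_rpow hδ.le ((le_inv_comm₀ hx hδ).1 hxδ) (by norm_num)

local notation3 "μ" => bondPercolation (zdGraph 2) half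

namespace S5


/-! ## The level flip `x ↦ (C - x₁, -x₀)` -/

-- adapted from `Theorems/CardyComplexConeEdgePrecompactHalfArmLeStrip.lean` (`exists_levelFlip`, private there)
/-- The automorphism `x ↦ (C - x₁, -x₀)` of `ℤ²`: it sends the level `x₀ + x₁` to `C -` level and the
column `x₀ - x₁` to `C +` column. [folklore] -/
theorem exists_flipIso (C : ℤ) : ∃ Φ : zdGraph 2 ≃g zdGraph 2, ∀ x : Site 2,
    Φ x 0 + Φ x 1 = C - (x 0 + x 1) ∧ Φ x 0 - Φ x 1 = C + (x 0 - x 1) := by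
  refine ⟨(zdShiftIso (Pi.single 0 C)).comp (zdSignedPermIso (Equiv.swap 0 1) fun _ => -1), fun x => ?_⟩
  simp only [SimpleGraph.Iso.coe_comp, Function.comp_apply, zdShiftIso_apply, zdSignedPermIso_apply, Pi.add_apply,
    Site.signedPerm_apply, Equiv.symm_swap, Equiv.swap_apply_left, Equiv.swap_apply_right, Units.val_neg, Units.val_one]
  simp
  constructor <;> ring

/-- Images under the level flip of sets described by level and column. [folklore] -/
theorem image_flipIso {C : ℤ} (Φ : zdGraph 2 ≃g zdGraph 2)
    (hΦ : ∀ x : Site 2, Φ x 0 + Φ x 1 = C - (x 0 + x 1) ∧ Φ x 0 - Φ x 1 = C + (x 0 - x 1))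
    (P : ℤ → ℤ → Prop) {S T : Set (Site 2)} (hS : ∀ x, x ∈ S ↔ P (x 0 + x 1) (x 0 - x 1))
    (hT : ∀ y, y ∈ T ↔ P (C - (y 0 + y 1)) (y 0 - y 1 - C)) : Φ '' S = T := by
  ext y
  constructor
  · rintro ⟨x, hx, rfl⟩
    rw [hS] at hx; rw [hT]; obtain ⟨h1, h2⟩ := hΦ x
    rwa [show C - (Φ x 0 + Φ x 1) = x 0 + x 1 by omega, show Φ x 0 - Φ x 1 - C = x 0 - x 1 by omega]
  · intro hy
    refine ⟨Φ.symm y, ?_, RelIso.apply_symm_apply Φ y⟩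
    rw [hT] at hy; rw [hS]; obtain ⟨h1, h2⟩ := hΦ (Φ.symm y)
    rw [RelIso.apply_symm_apply] at h1 h2
    rwa [show Φ.symm y 0 + Φ.symm y 1 = C - (y 0 + y 1) by omega,
      show Φ.symm y 0 - Φ.symm y 1 = y 0 - y 1 - C by omega]

/-! ## Ikhlef–Ponsaing's strip law as a local arm in standard position -/

/-- **IP as a local arm.** Under `IkhlefPonsaingFirstPassage`, a site `b₀` of level `1` is joined inside
the strip `{0 ≤ level ≤ 2a+1}` to the level `2a+1` with probability exactly `ipRatio a` (the level flip
`x ↦ (2a+1 - x₁, -x₀)` of `wallConn (2a+1) b'`, `b'` of level `2a`). [cite: IkhlefPonsaing2012, Prop. 4.7] -/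
theorem real_stripArm_eq (hIP : Literature.Probability.Percolation.IkhlefPonsaingFirstPassage) (a : ℕ)
    (b₀ : Site 2) (hb₀ : hgtOf b₀ = 1) :
    (μ).real (openCrossing {v : Site 2 | 0 ≤ hgtOf v ∧ hgtOf v ≤ 2 * a + 1} {b₀}
      {v : Site 2 | hgtOf v = 2 * a + 1}) = ipRatio a := by
  obtain ⟨Φ, hΦ⟩ := exists_flipIso (2 * a + 1 : ℤ)
  set b' := Φ.symm b₀ with hb'
  have hΦb' : Φ b' = b₀ := RelIso.apply_symm_apply Φ b₀
  have hlev : b' 0 + b' 1 = 2 * a := by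
    have h := (hΦ b').1; rw [hΦb'] at h; simp only [hgtOf] at hb₀; omega
  rw [← stub_ipExact_of_IkhlefPonsaing hIP a b' hlev]
  have hW : wallConn (2 * a + 1) b' = openCrossing (diagStrip (2 * a + 1)) {b'} {w | w 0 + w 1 = 0} := by
    ext ω; simp only [wallConn, Set.mem_setOf_eq, mem_openCrossing_iff, Set.mem_singleton_iff, exists_eq_left]
  rw [hW, ← bondPercolation_real_image Φ half (diagStrip (2 * a + 1)) {b'} {w : Site 2 | w 0 + w 1 = 0}]
  have e1 : Φ '' diagStrip (2 * a + 1) = {v : Site 2 | 0 ≤ hgtOf v ∧ hgtOf v ≤ 2 * a + 1} :=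
    image_flipIso Φ hΦ (fun s _ => 0 ≤ s ∧ s ≤ ((2 * a + 1 : ℕ) : ℤ)) (fun x => Iff.rfl)
      (fun y => by simp only [Set.mem_setOf_eq, hgtOf]; push_cast; omega)
  have e2 : Φ '' {b'} = {b₀} := by rw [Set.image_singleton, hΦb']
  have e3 : Φ '' {w : Site 2 | w 0 + w 1 = 0} = {v : Site 2 | hgtOf v = 2 * a + 1} :=
    image_flipIso Φ hΦ (fun s _ => s = 0) (fun x => Iff.rfl)
      (fun y => by simp only [Set.mem_setOf_eq, hgtOf]; omega)
  rw [e1, e2, e3]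

local notation3 "ν[" b ", " v "]" => max |col v - col b| (hgtOf v - hgtOf b)
local notation3 "box[" A₁ ", " A₂ ", " B₁ ", " B₂ "]" =>
  {v : Site 2 | A₁ ≤ col v ∧ col v ≤ A₂ ∧ B₁ ≤ hgtOf v ∧ hgtOf v ≤ B₂}
local notation3 "LR[" A₁ ", " A₂ ", " B₁ ", " B₂ "]" =>
  openCrossing box[A₁, A₂, B₁, B₂] {v : Site 2 | col v = A₁} {v : Site 2 | col v = A₂}
local notation3 "TB[" A₁ ", " A₂ ", " B₁ ", " B₂ "]" =>
  openCrossing box[A₁, A₂, B₁, B₂] {v : Site 2 | hgtOf v = B₁} {v : Site 2 | hgtOf v = B₂}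
local notation3 "U[" b ", " a "]" =>
  TB[col b + a, col b + 2 * a, 0, hgtOf b + 2 * a] ∩ LR[col b - 2 * a, col b + 2 * a, hgtOf b + a, hgtOf b + 2 * a] ∩
    TB[col b - 2 * a, col b - a, 0, hgtOf b + 2 * a]

/-- The strip arm, clipped at its first visit to half-plane distance `2a` from `b₀`, is an open
crossing of the finite box `box[col b₀ - 2a, col b₀ + 2a, 0, hgtOf b₀ + 2a]` from `b₀` to
`{ν[b₀, ·] = 2a}`. [folklore] -/
theorem stripArm_subset {ω : BondConfig (Site 2)} (hω : ω ⊆ (zdGraph 2).edgeSet) {b₀ : Site 2}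
    (hb₀ : hgtOf b₀ = 1) {a : ℤ} (ha : 0 ≤ a)
    (h : ω ∈ openCrossing {v : Site 2 | 0 ≤ hgtOf v ∧ hgtOf v ≤ 2 * a + 1} {b₀} {v : Site 2 | hgtOf v = 2 * a + 1}) :
    ω ∈ openCrossing box[col b₀ - 2 * a, col b₀ + 2 * a, 0, hgtOf b₀ + 2 * a] {b₀} {v : Site 2 | ν[b₀, v] = 2 * a} := by
  obtain ⟨x, hx, y, hy, hxy⟩ := h
  rw [mem_singleton_iff] at hx; subst hx; have hy : hgtOf y = 2 * a + 1 := hy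
  obtain ⟨z, hz, hconn⟩ := exists_openConnIn_le_level hω (fun v => ν[x, v]) (norm_le_of_adj diag_X_le diag_Y_le x)
    (2 * a) (by simp; omega) (le_max_of_le_right (by omega)) hxy
  refine ⟨x, mem_singleton _, z, hz, openConnIn_mono (fun v hv => ?_) _ _ hconn⟩
  obtain ⟨⟨h0, h1⟩, h2⟩ := hv
  have h2 : ν[x, v] ≤ 2 * a := h2; rw [max_le_iff, abs_le] at h2; exact ⟨by omega, by omega, h0, by omega⟩

/-- **Deterministic gluing.** On a lattice configuration: the wall edge `s(w₀, b₀)` is open, the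
clipped strip arm from `b₀`, the U `U[b₀, a]` and a deep top–bottom crossing of
`box[col b₀ - a, col b₀ + a, hgtOf b₀ + a, hgtOf b₀ + a + h]` together contain an open path from `w₀`
to the level `hgtOf = H` inside the band `{|col - col w₀| ≤ 2a + 1, 0 ≤ hgtOf ≤ H}` (the U catches the
arm, `uCatch`; the deep crossing meets the bar of the U, `meet`; stop at the first visit to level `H`).
[cite: Nolin2008, §4.3, proof of Prop. 12 (i) (arXiv 0711.4948: Prop. 11), with §4.6] -/
theorem mem_band_of_glue {ω : BondConfig (Site 2)} (hω : ω ⊆ (zdGraph 2).edgeSet) {w₀ b₀ : Site 2}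
    (hw₀ : hgtOf w₀ = 0) (hb₀ : hgtOf b₀ = 1) (hcol : col b₀ = col w₀ + 1) (hne : w₀ ≠ b₀)
    {a h H : ℤ} (ha : 1 ≤ a) (hah : a ≤ h) (hH0 : 0 ≤ H) (hH : H ≤ hgtOf b₀ + a + h)
    (h₁ : s(w₀, b₀) ∈ ω)
    (h₂ : ω ∈ openCrossing box[col b₀ - 2 * a, col b₀ + 2 * a, 0, hgtOf b₀ + 2 * a] {b₀} {v : Site 2 | ν[b₀, v] = 2 * a})
    (h₃ : ω ∈ U[b₀, a]) (h₄ : ω ∈ TB[col b₀ - a, col b₀ - a + 2 * a, hgtOf b₀ + a, hgtOf b₀ + a + h]) :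
    ω ∈ openCrossing {v : Site 2 | |col v - col w₀| ≤ 2 * a + 1 ∧ 0 ≤ hgtOf v ∧ hgtOf v ≤ H} {w₀}
      {v : Site 2 | hgtOf v = H} := by
  -- the band
  set T : Set (Site 2) := {v | col b₀ - 2 * a ≤ col v ∧ col v ≤ col b₀ + 2 * a ∧ 0 ≤ hgtOf v} with hT
  obtain ⟨⟨⟨xR, hxR, yR, hyR, hR⟩, hBarE⟩, ⟨xL, hxL, yL, hyL, hL⟩⟩ := h₃
  -- the deep crossing meets the bar
  obtain ⟨v, -, -, ⟨xB, hxB, hxv⟩, ⟨yB, hyB, hvy⟩, -, ⟨y', hy', hvy'⟩⟩ := meet isIsoradial_dia isRhombicTiling_dia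
    one_pos diag_re diag_im hω
    (S := box[col b₀ - 2 * a, col b₀ + 2 * a, hgtOf b₀ + a, hgtOf b₀ + 2 * a])
    (A := {v : Site 2 | col v = col b₀ - 2 * a}) (B := {v : Site 2 | col v = col b₀ + 2 * a})
    (S' := box[col b₀ - a, col b₀ - a + 2 * a, hgtOf b₀ + a, hgtOf b₀ + a + h])
    (A' := {v : Site 2 | hgtOf v = hgtOf b₀ + a}) (B' := {v : Site 2 | hgtOf v = hgtOf b₀ + a + h})
    (a₁ := col b₀ - a) (a₂ := col b₀ + a) (c₁ := hgtOf b₀ + a) (c₂ := hgtOf b₀ + 2 * a) (by omega) (by omega)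
    (fun v hv => hv.2.2) (fun v hv => by have hv : col v = _ := hv; omega)
    (fun v hv => by have hv : col v = _ := hv; omega) (fun v hv => ⟨hv.1, by linarith [hv.2.1]⟩)
    (fun v hv => by have hv : hgtOf v = _ := hv; omega) (fun v hv => by have hv : hgtOf v = _ := hv; omega)
    hBarE h₄
  have hxB : col xB = col b₀ - 2 * a := hxB; have hyB : col yB = col b₀ + 2 * a := hyB
  have hy' : hgtOf y' = hgtOf b₀ + a + h := hy'
  -- the U catches the arm
  obtain ⟨x, hx, z, hz, hxz⟩ := h₂
  rw [mem_singleton_iff] at hx; subst hx; have hz : ν[x, z] = 2 * a := hz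
  have hcatch := uCatch diag_X_le diag_Y_le isIsoradial_dia isRhombicTiling_dia one_pos diag_re diag_im hω
    (b := x) (by omega) ha (PlanarDuality.openConnIn_trans hxv hvy) hxB hyB hR hxR hyR hL hxL hyL
    (S := box[col x - 2 * a, col x + 2 * a, 0, hgtOf x + 2 * a]) (fun v hv => hv.2.2.1) hxz
    (by simp; omega) hz.ge
  -- everything inside the band `T`
  have sub1 : box[col x - 2 * a, col x + 2 * a, 0, hgtOf x + 2 * a] ∪
      box[col x - 2 * a, col x + 2 * a, 0, hgtOf x + 2 * a] ⊆ T := by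
    rintro v (hv | hv) <;> exact ⟨hv.1, hv.2.1, hv.2.2.1⟩
  have sub2 : box[col x - 2 * a, col x + 2 * a, hgtOf x + a, hgtOf x + 2 * a] ⊆ T :=
    fun v hv => ⟨hv.1, hv.2.1, by linarith [hv.2.2.1]⟩
  have sub3 : box[col x - a, col x - a + 2 * a, hgtOf x + a, hgtOf x + a + h] ⊆ T :=
    fun v hv => ⟨by linarith [hv.1], by linarith [hv.2.1], by linarith [hv.2.2.1]⟩
  have hwT : w₀ ∈ T := ⟨by rw [hcol]; omega, by rw [hcol]; omega, by rw [hw₀]⟩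
  have hxT : x ∈ T := ⟨by omega, by omega, by omega⟩
  have g : ω ∈ openConnIn T w₀ y' :=
    conn_trans subset_rfl sub3
      (conn_trans subset_rfl sub2 (conn_trans subset_rfl sub1 (openConnIn_of_adj hwT hxT h₁ hne) hcatch) hxv) hvy'
  -- stop at the first visit to the level `H`
  obtain ⟨q, hq, hconn⟩ := exists_openConnIn_le_level hω hgtOf diag_Y_le H (by rw [hw₀]; exact hH0)
    (by rw [hy']; exact hH) g
  refine ⟨w₀, mem_singleton _, q, hq, openConnIn_mono (fun v hv => ?_) _ _ hconn⟩
  obtain ⟨⟨hv1, hv2, hv3⟩, hv4⟩ := hv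
  exact ⟨by rw [abs_le]; constructor <;> omega, hv3, hv4⟩

/-- **The percolation estimate in standard position**: there are `c > 0`, `L₀` such that for `n ≥ L₀`,
`1 ≤ H ≤ 3n` and every wall site `w₀` (level `0`) there is a band half-width `r ≤ n/32` with
`c · n^{-1/3} ≤ P(w₀ is joined to the level H inside {|col - col w₀| ≤ r, 0 ≤ level ≤ H})` — the wall
edge, the clipped IP arm, the U and the deep crossing are increasing, measurable, of probabilities
`1/2`, `≥ ipRatio ⌊n/128⌋ ≥ n^{-1/3}`, `≥ c_U`, `≥ c_D`, and Harris–FKG. [cite: Nolin2008, §4.3, proof of Prop. 12 (i) (arXiv 0711.4948: Prop. 11), with §4.6] -/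
theorem armStd_lower (hIP : Literature.Probability.Percolation.IkhlefPonsaingFirstPassage) :
    ∃ c : ℝ, 0 < c ∧ ∃ L₀ : ℕ, ∀ n : ℕ, L₀ ≤ n → ∀ H : ℤ, 1 ≤ H → H ≤ 3 * n →
      ∀ w₀ : Site 2, hgtOf w₀ = 0 → ∃ r : ℕ, 32 * r ≤ n ∧
        c * (n : ℝ) ^ (-(1:ℝ) / 3) ≤ (μ).real (openCrossing
          {v : Site 2 | |col v - col w₀| ≤ r ∧ 0 ≤ hgtOf v ∧ hgtOf v ≤ H} {w₀} {v : Site 2 | hgtOf v = H}) := by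
  obtain ⟨cU, hcU, mU, hU⟩ := real_U_ge diag_X_le diag_Y_le diag_injective half diag_rswLR diag_rswTB
  obtain ⟨cD, hcD, mD, hD⟩ := tb_lower (X := col) diag_Y_le half diag_rswTB 256
  refine ⟨1 / 2 * cU * cD, by positivity, 128 * (mU + mD + 1) + 512, fun n hn H hH1 hH w₀ hw₀ => ?_⟩
  set a : ℕ := n / 128 with ha_def
  have ha1 : mU + mD + 5 ≤ a := by omega
  have ha128 : 128 * a ≤ n := by omega
  have hn4 : n < 128 * a + 128 := by omega
  set b₀ : Site 2 := w₀ + Pi.single 0 1 with hb₀_def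
  have hb₀ : hgtOf b₀ = 1 := by simp only [hgtOf] at hw₀ ⊢; simp [hb₀_def]; omega
  have hcol : col b₀ = col w₀ + 1 := by simp [hb₀_def, col]; ring
  have hne : w₀ ≠ b₀ := by intro h; have := congr_fun h 0; simp [hb₀_def] at this
  refine ⟨2 * a + 1, by omega, ?_⟩
  -- the four increasing events
  set E₁ : Set (BondConfig (Site 2)) := {ω | s(w₀, b₀) ∈ ω} with hE₁
  set W : Set (BondConfig (Site 2)) := openCrossing box[col b₀ - 2 * a, col b₀ + 2 * a, 0, hgtOf b₀ + 2 * a] {b₀}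
    {v : Site 2 | ν[b₀, v] = 2 * a} with hW
  set D : Set (BondConfig (Site 2)) := TB[col b₀ - a, col b₀ - a + 2 * a, hgtOf b₀ + a, hgtOf b₀ + a + 512 * a]
    with hD_def
  -- their probabilities
  have pE : (μ).real E₁ = 1 / 2 := by
    have h := bondPercolation_real_setOf_subset (zdGraph 2) half {s(w₀, b₀)} (by
      rw [Finset.coe_singleton, Set.singleton_subset_iff]; exact single_edge_mem w₀ 0)
    rw [Finset.card_singleton, pow_one, coe_half] at h
    rw [← h]; congr 1; ext ω; simp [hE₁]
  have pW : ipRatio a ≤ (μ).real W := by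
    rw [← real_stripArm_eq hIP a b₀ hb₀]
    refine ENNReal.toReal_mono (measure_ne_top _ _) (measure_mono_ae ?_)
    filter_upwards [ae_subset_edgeSet (zdGraph 2) half] with ω hω h
    exact stripArm_subset hω hb₀ (by positivity) h
  have pU : cU ≤ (μ).real U[b₀, (a : ℤ)] :=
    hU b₀ a (by rw [hb₀]; norm_num) (by omega) (by rw [hb₀]; omega)
  have pD : cD ≤ (μ).real D := by
    have := hD (2 * a) (by omega) (col b₀ - a) (hgtOf b₀ + a) (512 * a) (by positivity) (by push_cast; omega)
    push_cast at this; exact this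
  -- Harris–FKG
  have fin := box_finite diag_injective
  have mE : MeasurableSet E₁ := measurableSet_mem _
  have mW : MeasurableSet W := measurableSet_openCrossing_of_finite (fin _ _ _ _) _ _
  have mU' : MeasurableSet U[b₀, (a : ℤ)] :=
    ((measurableSet_openCrossing_of_finite (fin _ _ _ _) _ _).inter
      (measurableSet_openCrossing_of_finite (fin _ _ _ _) _ _)).inter
      (measurableSet_openCrossing_of_finite (fin _ _ _ _) _ _)
  have mD' : MeasurableSet D := measurableSet_openCrossing_of_finite (fin _ _ _ _) _ _
  have uE : IsUpperSet E₁ := fun ω ω' hle he => hle he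
  have uU : IsUpperSet U[b₀, (a : ℤ)] :=
    ((isUpperSet_openCrossing _ _ _).inter (isUpperSet_openCrossing _ _ _)).inter (isUpperSet_openCrossing _ _ _)
  have harris : (μ).real E₁ * (μ).real W * (μ).real U[b₀, (a : ℤ)] * (μ).real D ≤
      (μ).real (E₁ ∩ W ∩ U[b₀, (a : ℤ)] ∩ D) :=
    (mul_le_mul_of_nonneg_right (harris₃ half uE (isUpperSet_openCrossing _ _ _) uU mE mW mU')
      measureReal_nonneg).trans
      (harris_fkg_holds (zdGraph 2) half ((uE.inter (isUpperSet_openCrossing _ _ _)).inter uU)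
        (isUpperSet_openCrossing _ _ _) ((mE.inter mW).inter mU') mD')
  -- gluing
  have hsub : (μ).real (E₁ ∩ W ∩ U[b₀, (a : ℤ)] ∩ D) ≤ (μ).real (openCrossing
      {v : Site 2 | |col v - col w₀| ≤ ((2 * a + 1 : ℕ) : ℤ) ∧ 0 ≤ hgtOf v ∧ hgtOf v ≤ H} {w₀}
      {v : Site 2 | hgtOf v = H}) := by
    refine ENNReal.toReal_mono (measure_ne_top _ _) (measure_mono_ae ?_)
    filter_upwards [ae_subset_edgeSet (zdGraph 2) half] with ω hω h
    rw [show ((2 * a + 1 : ℕ) : ℤ) = 2 * (a : ℤ) + 1 by push_cast; ring]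
    exact mem_band_of_glue hω hw₀ hb₀ hcol hne (a := a) (h := 512 * a) (H := H) (by omega)
      (by omega) (by omega) (by rw [hb₀]; omega) h.1.1.1 h.1.1.2 h.1.2 h.2
  -- numerics
  have hip : (n : ℝ) ^ (-(1:ℝ) / 3) ≤ ipRatio a := by
    refine le_trans ?_ (ipRatio_lower a)
    exact Real.rpow_le_rpow_of_nonpos (by positivity) (by exact_mod_cast (show 2 * a + 1 ≤ n by omega))
      (by norm_num)
  calc 1 / 2 * cU * cD * (n : ℝ) ^ (-(1:ℝ) / 3)
      = 1 / 2 * (n : ℝ) ^ (-(1:ℝ) / 3) * cU * cD := by ring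
    _ ≤ (μ).real E₁ * (μ).real W * (μ).real U[b₀, (a : ℤ)] * (μ).real D := by
        rw [pE]; gcongr; exact hip.trans pW
    _ ≤ _ := harris
    _ ≤ _ := hsub

/-! ## Back on the anchor: from the band crossing to `bcBondConfig`-reachability of the wired arc -/

/-- **From the band crossing to the wired arc (deterministic).** On the discretised diagonal square of
size `L` (mesh domain, domain adjacency, boundary and far-arc hypotheses of `touchProb_lower`), an open
lattice path inside `{|column| ≤ L-2, -(L-1) ≤ level ≤ L-2}` ending at level `-(L-1)` is a path of
`E.bcBondConfig ω` (domain edges, no endpoint on the arc `B`) ending on the arc `A`. [folklore] -/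
theorem reachable_arcA_of_band {E : DiscreteDobrushin} {L : ℤ}
    (hmesh : ∀ v : Site 2, v ∈ meshDomain E.Ω E.δ ↔ |v 0 + v 1| ≤ L ∧ |v 0 - v 1| ≤ L)
    (hadj : ∀ v u : Site 2, v ∈ meshDomain E.Ω E.δ → u ∈ meshDomain E.Ω E.δ → (zdGraph 2).Adj v u →
      (discreteDomainGraph E.Ω E.δ).Adj v u)
    (hbd : ∀ v : Site 2, v ∈ E.zdBoundary ↔
      (|v 0 + v 1| ≤ L ∧ |v 0 - v 1| ≤ L) ∧ (L - 1 ≤ |v 0 + v 1| ∨ L - 1 ≤ |v 0 - v 1|))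
    (harc : ∀ v : Site 2, v ∈ E.zdBoundary → 4 * (v 0 + v 1) ≤ 3 * L → v ∈ E.zdArcA ∧ v ∉ E.zdArcB)
    {ω : BondConfig (Site 2)} (hω : ω ⊆ (zdGraph 2).edgeSet) {R : Set (Site 2)}
    (hR : ∀ v ∈ R, |v 0 - v 1| ≤ L - 2 ∧ -(L - 1) ≤ v 0 + v 1 ∧ v 0 + v 1 ≤ L - 2)
    {w z : Site 2} (hz : z 0 + z 1 = -(L - 1)) (h : ω ∈ openConnIn R w z) :
    z ∈ E.zdArcA ∧ (SimpleGraph.fromEdgeSet (E.bcBondConfig ω)).Reachable w z := by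
  have hdom : ∀ v ∈ R, v ∈ meshDomain E.Ω E.δ := fun v hv => by
    obtain ⟨h1, h2, h3⟩ := hR v hv
    rw [hmesh, abs_le, abs_le]; rw [abs_le] at h1; omega
  have hnotB : ∀ v ∈ R, v ∉ E.zdArcB := fun v hv hB => by
    obtain ⟨h1, h2, h3⟩ := hR v hv
    have hb := ((hbd v).1 (E.zdArcB_subset_zdBoundary hB)).2
    rw [abs_le] at h1; rw [le_abs, le_abs] at hb
    exact (harc v (E.zdArcB_subset_zdBoundary hB) (by omega)).2 hB
  obtain ⟨hwR, hzR, hr⟩ := h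
  have hzA : z ∈ E.zdArcA := by
    obtain ⟨h1, h2, h3⟩ := hR z hzR
    rw [abs_le] at h1
    refine (harc z ((hbd z).2 ⟨⟨?_, ?_⟩, Or.inl ?_⟩) (by omega)).1
    · rw [abs_le]; omega
    · rw [abs_le]; omega
    · rw [le_abs]; omega
  refine ⟨hzA, ?_⟩
  let φ : (openGraph ω).induce R →g SimpleGraph.fromEdgeSet (E.bcBondConfig ω) :=
    { toFun := fun v => v.1
      map_rel' := by
        intro u v huv
        rw [SimpleGraph.induce_adj, openGraph_adj] at huv
        obtain ⟨he, hne⟩ := huv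
        rw [SimpleGraph.fromEdgeSet_adj, E.mem_bcBondConfig_iff]
        have hadj' : (zdGraph 2).Adj u.1 v.1 := (SimpleGraph.mem_edgeSet _).1 (hω he)
        refine ⟨⟨(SimpleGraph.mem_edgeSet _).2 (hadj _ _ (hdom _ u.2) (hdom _ v.2) hadj'),
          Or.inr ⟨he, fun x hx => ?_⟩⟩, hne⟩
        rcases Sym2.mem_iff.1 hx with rfl | rfl
        exacts [hnotB _ u.2, hnotB _ v.2] }
  exact hr.map φ

/-- **`S5.touchProb_lower` (stub ARM).** Under Ikhlef–Ponsaing's strip law: on the discretised diagonal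
square `{|x₀+x₁| ≤ L, |x₀-x₁| ≤ L}` (every lattice point inside is a mesh-domain point, lattice neighbours
inside are domain-adjacent, the boundary is the two outer levels/columns, boundary sites of level
`≤ 3L/4` lie on the wired arc `A` and off `B`), a free-wall site `w` of level `L - 2` with
`2|x₀-x₁| ≤ L+2` is joined to `A` by open edges of `E.bcBondConfig ω` with probability `≥ c · L^{-1/3}`
(`armStd_lower` carried to the anchor by the level flip `x ↦ (L-2-x₁, -x₀)`, then
`reachable_arcA_of_band`). [cite: Nolin2008, §4.3, proof of Prop. 12 (i) (arXiv 0711.4948: Prop. 11), with §4.6] -/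
theorem touchProb_lower (hIP : Literature.Probability.Percolation.IkhlefPonsaingFirstPassage) :
    ∃ c : ℝ, 0 < c ∧ ∃ L₀ : ℕ, ∀ (E : DiscreteDobrushin) (L : ℤ), (L₀ : ℤ) ≤ L → E.IsZdAdmissible →
      (∀ v : Site 2, v ∈ meshDomain E.Ω E.δ ↔ |v 0 + v 1| ≤ L ∧ |v 0 - v 1| ≤ L) →
      (∀ v u : Site 2, v ∈ meshDomain E.Ω E.δ → u ∈ meshDomain E.Ω E.δ → (zdGraph 2).Adj v u →
        (discreteDomainGraph E.Ω E.δ).Adj v u) →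
      (∀ v : Site 2, v ∈ E.zdBoundary ↔
        (|v 0 + v 1| ≤ L ∧ |v 0 - v 1| ≤ L) ∧ (L - 1 ≤ |v 0 + v 1| ∨ L - 1 ≤ |v 0 - v 1|)) →
      (∀ v : Site 2, v ∈ E.zdBoundary → 4 * (v 0 + v 1) ≤ 3 * L → v ∈ E.zdArcA ∧ v ∉ E.zdArcB) →
      ∀ w : Site 2, w 0 + w 1 = L - 2 → 2 * |w 0 - w 1| ≤ L + 2 →
        c * (L : ℝ) ^ (-(1:ℝ) / 3) ≤ (bondPercolation (zdGraph 2) half).real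
          {ω : BondConfig (Site 2) | ∃ a ∈ E.zdArcA, (SimpleGraph.fromEdgeSet (E.bcBondConfig ω)).Reachable w a} := by
  obtain ⟨c, hc, L₀, hP⟩ := armStd_lower hIP
  refine ⟨c, hc, max L₀ 8, fun E L hL _hE hmesh hadj hbd harc w hw hdw => ?_⟩
  obtain ⟨n, rfl⟩ : ∃ n : ℕ, L = n := ⟨L.toNat, by push_cast at hL; omega⟩
  push_cast at hL
  have hn : L₀ ≤ n := by have := le_max_left L₀ 8; omega
  have hn8 : 8 ≤ n := by have := le_max_right L₀ 8; omega
  obtain ⟨Φ, hΦ⟩ := exists_flipIso ((n : ℤ) - 2)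
  obtain ⟨hsw, hcw⟩ := hΦ w
  have hw₀ : hgtOf (Φ w) = 0 := by simp only [hgtOf]; omega
  obtain ⟨r, hr, hPr⟩ := hP n hn (2 * n - 3) (by omega) (by omega) (Φ w) hw₀
  -- transport to the anchor position
  set R : Set (Site 2) := {v | |v 0 - v 1 - (w 0 - w 1)| ≤ r ∧ -((n : ℤ) - 1) ≤ v 0 + v 1 ∧ v 0 + v 1 ≤ n - 2}
    with hR
  have key := bondPercolation_real_image Φ half R {w} {v : Site 2 | v 0 + v 1 = -((n : ℤ) - 1)}
  have e1 : Φ '' R = {v : Site 2 | |col v - col (Φ w)| ≤ r ∧ 0 ≤ hgtOf v ∧ hgtOf v ≤ 2 * n - 3} :=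
    image_flipIso Φ hΦ (fun s d => |d - (w 0 - w 1)| ≤ r ∧ -((n : ℤ) - 1) ≤ s ∧ s ≤ n - 2) (fun _ => Iff.rfl)
      (fun y => by simp only [Set.mem_setOf_eq, col, hgtOf, abs_le]; omega)
  have e3 : Φ '' {v : Site 2 | v 0 + v 1 = -((n : ℤ) - 1)} = {v : Site 2 | hgtOf v = 2 * n - 3} :=
    image_flipIso Φ hΦ (fun s _ => s = -((n : ℤ) - 1)) (fun _ => Iff.rfl)
      (fun y => by simp only [Set.mem_setOf_eq, hgtOf]; omega)
  rw [e1, Set.image_singleton, e3] at key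
  rw [key] at hPr; rw [show (((n : ℤ) : ℝ)) = (n : ℝ) from Int.cast_natCast n]
  refine hPr.trans (ENNReal.toReal_mono (measure_ne_top _ _) (measure_mono_ae ?_))
  filter_upwards [ae_subset_edgeSet (zdGraph 2) half] with ω hω h
  obtain ⟨x, hx, z, hz, hxz⟩ := h
  rw [mem_singleton_iff] at hx; subst hx; have hz : z 0 + z 1 = -((n : ℤ) - 1) := hz
  have hd1 := le_abs_self (x 0 - x 1); have hd2 := neg_abs_le (x 0 - x 1)
  obtain ⟨hzA, hreach⟩ := reachable_arcA_of_band (L := (n : ℤ)) hmesh hadj hbd harc hω (R := R)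
    (fun v hv => by obtain ⟨h1, h2, h3⟩ := hv; rw [abs_le] at h1 ⊢; omega) hz hxz
  exact ⟨z, hzA, hreach⟩

end S5

end Summit.CriticalPhenomena.CardyFormulaZ2.Theorems.ParafermionFamiliesToSLESix.StripAnchored

end
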